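import Mathlib
import Summits.NavierStokesRegularity.NavierStokesRegularity.Theorems.TaoLadderRungTwoBreakDSSFlights
import HarnessLib

/-!
# The DSS orbit generated by a ONE-SHIFT DATUM of the bi-infinite cascade lattice
# (renormalise ∘ shift ∘ flow = id ⟹ discretely self-similar blow-up orbit), kernel form of
# `rung1/STAGE2-LEMMA.md` Lemma 2 (cell harvest/h2-tao-ladder, seat p2; support for K1(1) =
# `TaoLadderRungTwoBreak.NoSurvivingDSSOne`, stmt-NavierStokesRegularity-20205)

MODEL statement about the abstract nearest-neighbour lattice
`U_k' = λ^k (Q(U_k) + A₀(U_{k-1}) + B₀(U_{k+1}, U_k))` (`Q`, `A₀` homogeneous of degree two, `B₀` of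
degree one in each slot — Tao's circuit and every four-mode table in the tree's normal form, with
`A₀ = Λ⁻¹A`); nothing here is a statement about the Navier–Stokes equations; no item is closed.

A ONE-SHIFT DATUM is a solution `U` on the closed flight `[0, τ]` (every shell `k ∈ ℤ`, one-sided
derivatives at the ends) with `g • U_{k+1}(τ) = U_k(0)` for all `k` (`0 < g`, `λ = g e^{T}`,
`T > 0`): after one flight the state is the shifted, `g⁻¹`-rescaled copy of the initial state.  This
is exactly what p2's interval-validated fixed points of the one-shift renormalisation map are
(`rung1/STAGE2-LEMMA.md` (1.2)).  `exists_dssOrbit_of_oneShiftDatum` GLUES the rescaled flights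
`t ↦ g^{-j} U_{-j}(e^{jT}(t - t_j))`, `t_j = t⋆(1 - e^{-jT})`, `t⋆ = τ/(1 - e^{-T})`, `j ∈ ℤ`
(flight index `j = ⌊log(t⋆/(t⋆-t))/T⌋`), into ONE function `u = ` shell `0` of the DSS orbit on
`(-∞, t⋆)`, and proves: the shell-`0` law with the neighbours read through the DSS relations
(`U₋₁(t) = g u(t⋆ - e^{-T}(t⋆-t))`, `U₁(t) = g⁻¹ u(t⋆ - e^{T}(t⋆-t))`) at EVERY `t < t⋆` — inside
a flight by the scaling symmetry, at the junctions `t_j` by matching the one-sided derivatives with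
the datum relation —, the flight formula, and that the flights cover `(-∞, t⋆)`.  No uniqueness
theorem for the infinite lattice is used (the orbit is CONSTRUCTED).  Consumers:
`TaoCascade.isSWave_of_dssOrbit` (profile equation) and `DSSOneShift.isDSSWave_of_dssOrbit`.
-/

noncomputable section

-- `Summit.NavierStokesRegularity.NavierStokesRegularity.…` is the tree's (summit = problem) namespace; the
-- duplicated component is intended, so the dupNamespace linter is silenced for this file.
set_option linter.dupNamespace false

namespace Summit.NavierStokesRegularity.NavierStokesRegularity.Theorems

namespace DSSOneShift

open Filter Topology Set

/-! ## The glued orbit -/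

section Glue

variable {V : Type*} [NormedAddCommGroup V] [NormedSpace ℝ V]

/-- **One-shift datum ⟹ DSS orbit** (`rung1/STAGE2-LEMMA.md` Lemma 2, by construction).  Let `U`
solve the lattice `U_k' = λ^k (Q(U_k) + A₀(U_{k-1}) + B₀(U_{k+1}, U_k))` on the closed flight
`[0, τ]` (one-sided derivatives at the ends) for every shell `k ∈ ℤ`, with the ONE-SHIFT relation
`g • U_{k+1}(τ) = U_k(0)`; let `λ = g e^{T}`, `g > 0`, `T > 0`, and `τ = t⋆(1 - e^{-T})`.  Then
there is `u : ℝ → V` (shell `0` of the glued DSS orbit, blow-up time `t⋆`) such that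
(i) at every `t < t⋆`, `u' = Q(u) + A₀(g u(t⋆ - e^{-T}(t⋆ - t))) + B₀(g⁻¹ u(t⋆ - e^{T}(t⋆ - t)), u)`
— the shell-`0` law with the neighbouring shells read through the DSS relations;
(ii) on flight `j` (`t = t_j + e^{-jT}s`, `t_j = t⋆ - t⋆e^{-jT}`, `0 ≤ s < τ`): `u(t) = g^{-j} U_{-j}(s)`;
(iii) every `t < t⋆` lies on some flight.
[cite: Tao2016AveragedNS, §5.3–§6 (scale covariance of the cascade, self-similar blow-up); cell vocabulary, harvest/h2-tao-ladder rung1/STAGE2-LEMMA.md Lemma 2] -/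
theorem exists_dssOrbit_of_oneShiftDatum
    {Q A₀ : V → V} {B₀ : V → V → V}
    (hQ : ∀ (c : ℝ) (v : V), Q (c • v) = c ^ 2 • Q v)
    (hA : ∀ (c : ℝ) (v : V), A₀ (c • v) = c ^ 2 • A₀ v)
    (hB1 : ∀ (c : ℝ) (v w : V), B₀ (c • v) w = c • B₀ v w)
    (hB2 : ∀ (c : ℝ) (v w : V), B₀ v (c • w) = c • B₀ v w)
    {lam g τ T tstar : ℝ} (hg : 0 < g) (hT : 0 < T) (hlam : lam = g * Real.exp T) (hτ : 0 < τ)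
    (htstar : τ = tstar * (1 - Real.exp (-T)))
    {U : ℤ → ℝ → V}
    (hU : ∀ (k : ℤ) (s : ℝ), s ∈ Icc 0 τ → HasDerivWithinAt (U k)
      (lam ^ k • (Q (U k s) + A₀ (U (k - 1) s) + B₀ (U (k + 1) s) (U k s))) (Icc 0 τ) s)
    (hshift : ∀ k : ℤ, g • U (k + 1) τ = U k 0) :
    ∃ u : ℝ → V,
      (∀ t, t < tstar → HasDerivAt u
        (Q (u t) + A₀ (g • u (tstar - Real.exp (-T) * (tstar - t)))
          + B₀ (g⁻¹ • u (tstar - Real.exp T * (tstar - t))) (u t)) t) ∧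
      (∀ (j : ℤ) (s : ℝ), s ∈ Ico 0 τ →
        u (tstar - tstar * Real.exp (-((j : ℝ) * T)) + Real.exp (-((j : ℝ) * T)) * s)
          = (g ^ j)⁻¹ • U (-j) s) ∧
      (∀ t, t < tstar → ∃ (j : ℤ) (s : ℝ), s ∈ Ico 0 τ ∧
        t = tstar - tstar * Real.exp (-((j : ℝ) * T)) + Real.exp (-((j : ℝ) * T)) * s) := by
  -- positivity of `t⋆`
  have hE1 : Real.exp (-T) < 1 := by
    rw [← Real.exp_zero]; exact Real.exp_lt_exp.2 (by linarith)
  have htstar_pos : 0 < tstar := by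
    by_contra h
    have : tstar * (1 - Real.exp (-T)) ≤ 0 :=
      mul_nonpos_of_nonpos_of_nonneg (not_lt.1 h) (by linarith)
    linarith
  -- the flight data, introduced with defining equations
  set a := Real.log g with ha_def
  have hga : Real.exp a = g := Real.exp_log hg
  obtain ⟨ts, hts⟩ : ∃ ts : ℤ → ℝ, ∀ j, ts j = tstar - tstar * Real.exp (-((j : ℝ) * T)) :=
    ⟨_, fun _ => rfl⟩
  obtain ⟨loc, hloc⟩ : ∃ loc : ℤ → ℝ → ℝ,
      ∀ j t, loc j t = Real.exp ((j : ℝ) * T) * (t - ts j) := ⟨_, fun _ _ => rfl⟩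
  obtain ⟨pc, hpc⟩ : ∃ pc : ℤ → ℝ → V,
      ∀ j t, pc j t = Real.exp (-((j : ℝ) * a)) • U (-j) (loc j t) := ⟨_, fun _ _ => rfl⟩
  obtain ⟨idx, hidx⟩ : ∃ idx : ℝ → ℤ, ∀ t, idx t = ⌊Real.log (tstar / (tstar - t)) / T⌋ :=
    ⟨_, fun _ => rfl⟩
  -- elementary flight facts
  have hts_succ : ∀ j : ℤ, ts (j + 1) = tstar - tstar * Real.exp (-(((j : ℝ) + 1) * T)) := by
    intro j; rw [hts]; push_cast; ring_nf
  have hts_lt_tstar : ∀ j : ℤ, ts j < tstar := by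
    intro j; rw [hts]
    have : 0 < tstar * Real.exp (-((j : ℝ) * T)) := mul_pos htstar_pos (Real.exp_pos _)
    linarith
  have hflight : ∀ t, t < tstar → ts (idx t) ≤ t ∧ t < ts (idx t + 1) := by
    intro t ht
    rw [hts, hts_succ]
    exact (floor_flight_iff hT htstar_pos ht (idx t)).1 (hidx t).symm
  have hidx_eq : ∀ (t : ℝ) (j : ℤ), t < tstar → ts j ≤ t → t < ts (j + 1) → idx t = j := by
    intro t j ht h1 h2
    rw [hidx]
    rw [hts] at h1
    rw [hts_succ] at h2
    exact (floor_flight_iff hT htstar_pos ht j).2 ⟨h1, h2⟩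
  have hlen : ∀ j : ℤ, loc j (ts (j + 1)) = τ := by
    intro j; rw [hloc, hts_succ, hts]; exact loc_end htstar j
  have hloc_ts : ∀ j : ℤ, loc j (ts j) = 0 := by intro j; rw [hloc]; simp
  have hts_lt : ∀ j : ℤ, ts j < ts (j + 1) := by
    intro j
    have h := hlen j
    rw [hloc] at h
    have hpos : 0 < Real.exp ((j : ℝ) * T) := Real.exp_pos _
    nlinarith
  have hgap : ∀ j : ℤ, ts (j + 1) - ts j = Real.exp (-((j : ℝ) * T)) * τ := by
    intro j
    have h := hlen j
    rw [hloc] at h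
    have h3 : Real.exp (-((j : ℝ) * T)) * Real.exp ((j : ℝ) * T) = 1 := by
      rw [← Real.exp_add, neg_add_cancel, Real.exp_zero]
    calc ts (j + 1) - ts j
        = Real.exp (-((j : ℝ) * T)) * (Real.exp ((j : ℝ) * T) * (ts (j + 1) - ts j)) := by
          rw [← mul_assoc, h3, one_mul]
      _ = Real.exp (-((j : ℝ) * T)) * τ := by rw [h]
  have hloc_maps : ∀ j : ℤ, MapsTo (loc j) (Icc (ts j) (ts (j + 1))) (Icc 0 τ) := by
    intro j x hx
    have h0 := hloc_ts j
    have h1 := hlen j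
    rw [← h0, ← h1, hloc, hloc, hloc]
    exact ⟨mul_le_mul_of_nonneg_left (by linarith [hx.1]) (Real.exp_pos _).le,
      mul_le_mul_of_nonneg_left (by linarith [hx.2]) (Real.exp_pos _).le⟩
  have hloc_deriv : ∀ (j : ℤ) (S : Set ℝ) (t : ℝ),
      HasDerivWithinAt (loc j) (Real.exp ((j : ℝ) * T)) S t := by
    intro j S t
    have hfun : loc j = fun x => Real.exp ((j : ℝ) * T) * (x - ts j) := funext (hloc j)
    rw [hfun]
    simpa using
      (((hasDerivAt_id t).sub_const (ts j)).const_mul (Real.exp ((j : ℝ) * T))).hasDerivWithinAt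
  -- the amplitude bookkeeping: `e_j := e^{-ja}`, `g e_{j+1} = e_j = g⁻¹ e_{j-1}`, `e_j e^{jT} λ^{-j} = e_j²`
  have he_succ : ∀ j : ℤ, g * Real.exp (-((((j + 1 : ℤ)) : ℝ) * a)) = Real.exp (-((j : ℝ) * a)) := by
    intro j; rw [← hga, ← Real.exp_add]; push_cast; ring_nf
  have he_pred : ∀ j : ℤ, g⁻¹ * Real.exp (-((((j - 1 : ℤ)) : ℝ) * a)) = Real.exp (-((j : ℝ) * a)) := by
    intro j; rw [← hga, ← Real.exp_neg, ← Real.exp_add]; push_cast; ring_nf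
  have he_sq : ∀ j : ℤ, Real.exp (-((j : ℝ) * a)) * Real.exp ((j : ℝ) * T) * lam ^ (-j)
      = Real.exp (-((j : ℝ) * a)) * Real.exp (-((j : ℝ) * a)) := by
    intro j; rw [mul_assoc, exp_mul_zpow_neg hg hlam j]
  -- the datum's one-sided derivatives transported to the closed flight `j`
  have hderiv_pc : ∀ (j : ℤ) (t : ℝ), t ∈ Icc (ts j) (ts (j + 1)) →
      HasDerivWithinAt (pc j)
        ((Real.exp (-((j : ℝ) * a)) * Real.exp (-((j : ℝ) * a))) •
          (Q (U (-j) (loc j t)) + A₀ (U (-j - 1) (loc j t))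
            + B₀ (U (-j + 1) (loc j t)) (U (-j) (loc j t))))
        (Icc (ts j) (ts (j + 1))) t := by
    intro j t ht
    have hf := hU (-j) (loc j t) (hloc_maps j ht)
    have hcomp := (hf.scomp t (hloc_deriv j _ t) (hloc_maps j)).const_smul
      (Real.exp (-((j : ℝ) * a)))
    have hfun : pc j = fun x => Real.exp (-((j : ℝ) * a)) • (U (-j) ∘ loc j) x :=
      funext fun x => by rw [hpc]; rfl
    rw [hfun]
    refine hcomp.congr_deriv ?_
    rw [smul_smul, smul_smul, he_sq]
  -- THE GLUED FUNCTION
  refine ⟨fun t => pc (idx t) t, ?_, ?_, ?_⟩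
  · -- (i) the law at every `t < t⋆`
    intro t ht
    obtain ⟨hj1, hj2⟩ := hflight t ht
    set j := idx t with hj_def
    -- the two phase-shifted points and their flight indices
    have hφlt : tstar - Real.exp (-T) * (tstar - t) < tstar := by
      have : 0 < Real.exp (-T) * (tstar - t) := mul_pos (Real.exp_pos _) (by linarith)
      linarith
    have hψlt : tstar - Real.exp T * (tstar - t) < tstar := by
      have : 0 < Real.exp T * (tstar - t) := mul_pos (Real.exp_pos _) (by linarith)
      linarith
    have hj1' : tstar - tstar * Real.exp (-((j : ℝ) * T)) ≤ t := by rw [← hts]; exact hj1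
    have hj2' : t < tstar - tstar * Real.exp (-(((j : ℝ) + 1) * T)) := by
      rw [← hts_succ]; exact hj2
    have hidxφ : idx (tstar - Real.exp (-T) * (tstar - t)) = j + 1 := by
      obtain ⟨h1, h2⟩ := flight_succ j hj1' hj2'
      exact hidx_eq _ _ hφlt (by rw [hts]; exact h1) (by rw [hts_succ]; exact h2)
    have hidxψ : idx (tstar - Real.exp T * (tstar - t)) = j - 1 := by
      obtain ⟨h1, h2⟩ := flight_pred j hj1' hj2'
      exact hidx_eq _ _ hψlt (by rw [hts]; exact h1) (by rw [hts_succ]; exact h2)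
    have hlocφ : loc (j + 1) (tstar - Real.exp (-T) * (tstar - t)) = loc j t := by
      rw [hloc, hloc, hts, hts]; exact loc_succ j
    have hlocψ : loc (j - 1) (tstar - Real.exp T * (tstar - t)) = loc j t := by
      rw [hloc, hloc, hts, hts]; exact loc_pred j
    -- the target derivative equals the flight-`j` derivative
    set s := loc j t with hs_def
    have htarget :
        Q (pc (idx t) t) + A₀ (g • pc (idx (tstar - Real.exp (-T) * (tstar - t)))
            (tstar - Real.exp (-T) * (tstar - t)))
          + B₀ (g⁻¹ • pc (idx (tstar - Real.exp T * (tstar - t)))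
            (tstar - Real.exp T * (tstar - t))) (pc (idx t) t)
        = (Real.exp (-((j : ℝ) * a)) * Real.exp (-((j : ℝ) * a))) •
          (Q (U (-j) s) + A₀ (U (-j - 1) s) + B₀ (U (-j + 1) s) (U (-j) s)) := by
      rw [hidxφ, hidxψ, ← hj_def, hpc, hpc, hpc, hlocφ, hlocψ, ← hs_def, smul_smul, smul_smul,
        he_succ, he_pred, hQ, hA, hB1, hB2,
        show (-(j + 1) : ℤ) = -j - 1 by ring, show (-(j - 1) : ℤ) = -j + 1 by ring]
      rw [smul_add, smul_add, smul_smul, sq]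
    -- right derivative (within `[t, +∞)`): flight `j`
    have hR : HasDerivWithinAt (fun t' => pc (idx t') t')
        ((Real.exp (-((j : ℝ) * a)) * Real.exp (-((j : ℝ) * a))) •
          (Q (U (-j) s) + A₀ (U (-j - 1) s) + B₀ (U (-j + 1) s) (U (-j) s))) (Ici t) t := by
      have h1 := hderiv_pc j t ⟨hj1, hj2.le⟩
      have h2 : HasDerivWithinAt (pc j) _ (Ici t) t :=
        h1.mono_of_mem_nhdsWithin (mem_of_superset (Icc_mem_nhdsGE hj2)
          (Icc_subset_Icc_left hj1))
      refine h2.congr_of_eventuallyEq ?_ (by simp only [← hj_def])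
      filter_upwards [Ico_mem_nhdsGE hj2] with t' ht'
      rw [hidx_eq t' j (lt_trans ht'.2 (hts_lt_tstar _)) (le_trans hj1 ht'.1) ht'.2]
    -- left derivative (within `(-∞, t]`): flight `j` if `t_j < t`, flight `j-1` at the junction
    have hL : HasDerivWithinAt (fun t' => pc (idx t') t')
        ((Real.exp (-((j : ℝ) * a)) * Real.exp (-((j : ℝ) * a))) •
          (Q (U (-j) s) + A₀ (U (-j - 1) s) + B₀ (U (-j + 1) s) (U (-j) s))) (Iic t) t := by
      rcases hj1.eq_or_lt with hjt | hjt
      · -- junction `t = t_j`: use flight `j-1` at local time `τ`, values matched by `hshift`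
        have hjm : j - 1 + 1 = j := sub_add_cancel j 1
        have hlt' : ts (j - 1) < t := by
          have := hts_lt (j - 1)
          rwa [hjm, hjt] at this
        have hmem : t ∈ Icc (ts (j - 1)) (ts (j - 1 + 1)) := by
          rw [hjm, hjt]; exact ⟨hlt'.le, le_rfl⟩
        have hlocτ : loc (j - 1) t = τ := by
          have := hlen (j - 1)
          rwa [hjm, hjt] at this
        have hs0 : s = 0 := by rw [hs_def, ← hjt, hloc_ts]
        have h1 := hderiv_pc (j - 1) t hmem
        rw [hlocτ] at h1
        have hnhds : Icc (ts (j - 1)) (ts (j - 1 + 1)) ∈ 𝓝[Iic t] t := by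
          rw [hjm, hjt]; exact Icc_mem_nhdsLE hlt'
        have h2 := h1.mono_of_mem_nhdsWithin hnhds
        -- values at `τ` through the one-shift relation
        have hv0 : U (-(j - 1)) τ = g⁻¹ • U (-j) 0 := by
          rw [show (-(j - 1) : ℤ) = -j + 1 by ring, ← hshift (-j), smul_smul,
            inv_mul_cancel₀ hg.ne', one_smul]
        have hv1 : U (-(j - 1) - 1) τ = g⁻¹ • U (-j - 1) 0 := by
          rw [show (-(j - 1) - 1 : ℤ) = -j - 1 + 1 by ring, ← hshift (-j - 1), smul_smul,
            inv_mul_cancel₀ hg.ne', one_smul]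
        have hv2 : U (-(j - 1) + 1) τ = g⁻¹ • U (-j + 1) 0 := by
          rw [show (-(j - 1) + 1 : ℤ) = -j + 1 + 1 by ring, ← hshift (-j + 1), smul_smul,
            inv_mul_cancel₀ hg.ne', one_smul]
        have h3 : HasDerivWithinAt (pc (j - 1))
            ((Real.exp (-((j : ℝ) * a)) * Real.exp (-((j : ℝ) * a))) •
              (Q (U (-j) s) + A₀ (U (-j - 1) s) + B₀ (U (-j + 1) s) (U (-j) s))) (Iic t) t := by
          refine h2.congr_deriv ?_
          rw [hv0, hv1, hv2, hQ, hA, hB1, hB2, hs0, ← he_pred j]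
          match_scalars <;> ring
        refine h3.congr_of_eventuallyEq ?_ ?_
        · filter_upwards [Icc_mem_nhdsLE hlt'] with t' ht'
          rcases ht'.2.eq_or_lt with h | h
          · -- at the junction itself: continuity of the glued function (`hshift`)
            rw [h, ← hj_def, hpc, hpc, hlocτ, hv0, ← hs_def, hs0, smul_smul, ← he_pred j, mul_comm]
          · rw [hidx_eq t' (j - 1) (h.trans ht) ht'.1 (by rw [hjm, hjt]; exact h)]
        · rw [← hj_def, hpc, hpc, hlocτ, hv0, ← hs_def, hs0, smul_smul, ← he_pred j, mul_comm]
      · -- interior from the left: flight `j`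
        have h1 := hderiv_pc j t ⟨hj1, hj2.le⟩
        have h2 : HasDerivWithinAt (pc j) _ (Iic t) t :=
          h1.mono_of_mem_nhdsWithin (mem_of_superset (Icc_mem_nhdsLE hjt)
            (Icc_subset_Icc_right hj2.le))
        refine h2.congr_of_eventuallyEq ?_ (by simp only [← hj_def])
        filter_upwards [Icc_mem_nhdsLE hjt] with t' ht'
        rw [hidx_eq t' j (lt_of_le_of_lt ht'.2 ht) ht'.1 (lt_of_le_of_lt ht'.2 hj2)]
    have hboth := hL.union hR
    rw [Iic_union_Ici, hasDerivWithinAt_univ] at hboth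
    exact hboth.congr_deriv htarget.symm
  · -- (ii) the flight formula
    intro j s hs
    have hpt_lt : tstar - tstar * Real.exp (-((j : ℝ) * T)) + Real.exp (-((j : ℝ) * T)) * s
        < ts (j + 1) := by
      have h := hgap j
      have h0 := hts j
      have : Real.exp (-((j : ℝ) * T)) * s < Real.exp (-((j : ℝ) * T)) * τ :=
        mul_lt_mul_of_pos_left hs.2 (Real.exp_pos _)
      linarith
    have hpt_ge : ts j ≤ tstar - tstar * Real.exp (-((j : ℝ) * T)) + Real.exp (-((j : ℝ) * T)) * s := by
      rw [hts]
      have : 0 ≤ Real.exp (-((j : ℝ) * T)) * s := mul_nonneg (Real.exp_pos _).le hs.1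
      linarith
    have hj : idx (tstar - tstar * Real.exp (-((j : ℝ) * T)) + Real.exp (-((j : ℝ) * T)) * s) = j :=
      hidx_eq _ j (hpt_lt.trans (hts_lt_tstar _)) hpt_ge hpt_lt
    show pc (idx _) _ = _
    rw [hj, hpc, hloc, hts, loc_of_local j, zpow_inv_eq_exp hg j]
  · -- (iii) the flights cover `(-∞, t⋆)`
    intro t ht
    obtain ⟨hj1, hj2⟩ := hflight t ht
    refine ⟨idx t, loc (idx t) t, ⟨?_, ?_⟩, ?_⟩
    · rw [← hloc_ts (idx t), hloc, hloc]
      exact mul_le_mul_of_nonneg_left (by linarith) (Real.exp_pos _).le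
    · rw [← hlen (idx t), hloc, hloc]
      exact mul_lt_mul_of_pos_left (by linarith) (Real.exp_pos _)
    · rw [hloc, hts]
      have h3 : Real.exp (-(((idx t : ℤ) : ℝ) * T)) * Real.exp (((idx t : ℤ) : ℝ) * T) = 1 := by
        rw [← Real.exp_add, neg_add_cancel, Real.exp_zero]
      linear_combination (-(t - (tstar - tstar * Real.exp (-(((idx t : ℤ) : ℝ) * T))))) * h3

end Glue

end DSSOneShift

end Summit.NavierStokesRegularity.NavierStokesRegularity.Theorems
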